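import Mathlib.MeasureTheory.Measure.Portmanteau
import Literature.Probability.RandomPlanarGeometry.CurveSpace

/-!
# `stub_lawClosed` — the closed-set portmanteau theorem for `TendstoLaw` (crux `PathUpgradeR`,
stmt-CriticalPhenomena-18055, route `SAWReversalUpgrade`, line `bidir_windows`)

Landing target:
`Summits/CriticalPhenomena/SAWScalingLimit/Theorems/SAWReversalUpgradePathUpgradeRLawClosed.lean`
(`--supports stmt-CriticalPhenomena-18055`; registered stub `stub_lawClosed` of
`Cruxes/PathUpgradeR/Lines/bidir_windows.lean`, statement verbatim).

**Theorem.** Let `S` be a pseudo-emetric Borel space, `P'` a probability law, `Z` a.e.-measurable,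
and let the laws `P δ` be eventually (along the mesh filter `𝓝[>] 0`) probability measures with
`Y δ` eventually a.e.-measurable. Then the tree's portmanteau-form convergence in law
`TendstoLaw Y P Z P'` (convergence of the integrals of bounded continuous test functions) is
equivalent to the closed-set condition: for every closed `F ⊆ S` and every `β > 0`, eventually
`P δ {Y δ ∈ F} ≤ P' {Z ∈ F} + β`.

**Proof.** Patch the (eventually absent) bad indices: choose probability measures `μ δ` on `S`
that agree with the law `(P δ).map (Y δ)` whenever `P δ` is a probability measure and `Y δ` is
a.e.-measurable. By `integral_map` and `Filter.tendsto_congr'`, `TendstoLaw Y P Z P'` is weak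
convergence `μ δ → law Z` in `ProbabilityMeasure S` (Mathlib's
`ProbabilityMeasure.tendsto_iff_forall_integral_tendsto`). The closed-set condition is, after the
same patching, `limsup_δ μ δ F ≤ law Z F` for all closed `F` (an `ℝ≥0∞`-valued `limsup` is `≤ c`,
`c < ∞`, iff the sequence is eventually `≤ c + β` for every `β > 0`). The two are equivalent by
Mathlib's portmanteau implications `ProbabilityMeasure.limsup_measure_closed_le_of_tendsto`
(pseudo-emetric spaces have `HasOuterApproxClosed`) and
`MeasureTheory.tendsto_of_forall_isClosed_limsup_le'` (the filter `𝓝[>] 0` on `ℝ` is countably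
generated) (Billingsley, *Convergence of probability measures*, 2nd ed., Thm 2.1). [folklore]
-/

noncomputable section

open scoped ENNReal NNReal Topology BoundedContinuousFunction
open MeasureTheory Filter Set
open Literature.Probability.RandomPlanarGeometry

namespace Summit.CriticalPhenomena.SAWScalingLimit.Theorems

namespace PathUpgradeRLawClosed

/-! ### Two `ℝ≥0∞`-valued `limsup` facts -/

/-- If `limsup u ≤ c` with `c ≠ ∞`, then for every `β > 0` eventually `u i ≤ c + β`. [folklore] -/
theorem eventually_le_add_of_limsup_le {ι : Type*} {L : Filter ι} {u : ι → ℝ≥0∞} {c β : ℝ≥0∞}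
    (hc : c ≠ ∞) (hβ : 0 < β) (h : limsup u L ≤ c) : ∀ᶠ i in L, u i ≤ c + β := by
  rcases eq_or_ne β ∞ with rfl | _
  · exact Eventually.of_forall fun i ↦ by simp
  have hlt : limsup u L < c + β := h.trans_lt (ENNReal.lt_add_right hc hβ.ne')
  exact (eventually_lt_of_limsup_lt hlt).mono fun i hi ↦ hi.le

/-- If for every `β > 0` eventually `u i ≤ c + β`, then `limsup u ≤ c`. [folklore] -/
theorem limsup_le_of_forall_eventually_le_add {ι : Type*} {L : Filter ι} {u : ι → ℝ≥0∞}
    {c : ℝ≥0∞} (h : ∀ β : ℝ≥0∞, 0 < β → ∀ᶠ i in L, u i ≤ c + β) : limsup u L ≤ c := by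
  refine ENNReal.le_of_forall_pos_le_add fun ε hε _ ↦ ?_
  exact limsup_le_of_le (by isBoundedDefault) (h ε (ENNReal.coe_pos.2 hε))

/-! ### Patching the eventually-bad indices -/

section Patch

variable {S : Type*} [MeasurableSpace S]
  {Ωδ : ℝ → Type*} [∀ δ, MeasurableSpace (Ωδ δ)] {Ω' : Type*} [MeasurableSpace Ω']

/-- There is a family of probability measures `μ δ` on `S` which eventually along `𝓝[>] 0` is
the law of `Y δ` under `P δ` (given any probability measure `ν` on `S` to use at the bad
indices). [folklore] -/
theorem exists_probabilityMeasure_eventually_eq_map {Y : ∀ δ, Ωδ δ → S}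
    {P : ∀ δ, Measure (Ωδ δ)} (ν : ProbabilityMeasure S)
    (hP : ∀ᶠ δ in 𝓝[>] (0 : ℝ), IsProbabilityMeasure (P δ))
    (hY : ∀ᶠ δ in 𝓝[>] (0 : ℝ), AEMeasurable (Y δ) (P δ)) :
    ∃ μ : ℝ → ProbabilityMeasure S, ∀ᶠ δ in 𝓝[>] (0 : ℝ),
      AEMeasurable (Y δ) (P δ) ∧ (μ δ : Measure S) = (P δ).map (Y δ) := by
  classical
  have hprob : ∀ δ, IsProbabilityMeasure (P δ) ∧ AEMeasurable (Y δ) (P δ) →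
      IsProbabilityMeasure ((P δ).map (Y δ)) := fun δ h ↦ by
    haveI := h.1
    exact Measure.isProbabilityMeasure_map h.2
  refine ⟨fun δ ↦ if h : IsProbabilityMeasure (P δ) ∧ AEMeasurable (Y δ) (P δ) then
    ⟨(P δ).map (Y δ), hprob δ h⟩ else ν, ?_⟩
  filter_upwards [hP, hY] with δ hδP hδY
  refine ⟨hδY, ?_⟩
  rw [dif_pos ⟨hδP, hδY⟩, ProbabilityMeasure.coe_mk]

/-- Eventually the patched measure of a measurable set is the `P δ`-probability that `Y δ` lies
in it. [folklore] -/
theorem eventually_apply_eq_of_eventually_eq {Y : ∀ δ, Ωδ δ → S} {P : ∀ δ, Measure (Ωδ δ)}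
    {μ : ℝ → ProbabilityMeasure S}
    (hμ : ∀ᶠ δ in 𝓝[>] (0 : ℝ), AEMeasurable (Y δ) (P δ) ∧ (μ δ : Measure S) = (P δ).map (Y δ))
    {F : Set S} (hF : MeasurableSet F) :
    ∀ᶠ δ in 𝓝[>] (0 : ℝ), (μ δ : Measure S) F = P δ (Y δ ⁻¹' F) := by
  filter_upwards [hμ] with δ hδ
  rw [hδ.2, Measure.map_apply_of_aemeasurable hδ.1 hF]

variable [TopologicalSpace S] [BorelSpace S]

/-- With a patched family `μ` (eventually the law of `Y δ`) and `μlim` the law of `Z`,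
`TendstoLaw Y P Z P'` is weak convergence `μ δ → μlim` of probability measures. [folklore] -/
theorem tendstoLaw_iff_tendsto_of_eventually_eq {Y : ∀ δ, Ωδ δ → S} {P : ∀ δ, Measure (Ωδ δ)}
    {Z : Ω' → S} {P' : Measure Ω'} (hZ : AEMeasurable Z P') {μ : ℝ → ProbabilityMeasure S}
    (hμ : ∀ᶠ δ in 𝓝[>] (0 : ℝ), AEMeasurable (Y δ) (P δ) ∧ (μ δ : Measure S) = (P δ).map (Y δ))
    {μlim : ProbabilityMeasure S} (hlim : (μlim : Measure S) = P'.map Z) :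
    TendstoLaw Y P Z P' ↔ Tendsto μ (𝓝[>] (0 : ℝ)) (𝓝 μlim) := by
  rw [ProbabilityMeasure.tendsto_iff_forall_integral_tendsto]
  refine forall_congr' fun f ↦ ?_
  rw [hlim, integral_map hZ f.continuous.aestronglyMeasurable]
  refine tendsto_congr' ?_
  filter_upwards [hμ] with δ hδ
  rw [hδ.2, integral_map hδ.1 f.continuous.aestronglyMeasurable]

end Patch

end PathUpgradeRLawClosed

open PathUpgradeRLawClosed in
/-- **Closed-set portmanteau theorem for `TendstoLaw` (registered stub `stub_lawClosed`).**
For a pseudo-emetric Borel space `S`, a probability law `P'`, an a.e.-measurable `Z`, laws `P δ`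
that are eventually probability measures and random elements `Y δ` that are eventually
a.e.-measurable, `TendstoLaw Y P Z P'` holds iff for every closed `F` and every `β > 0`,
eventually `P δ {Y δ ∈ F} ≤ P' {Z ∈ F} + β` (Billingsley 1999, Thm 2.1; Mathlib `Portmanteau`).
[folklore] -/
theorem stub_lawClosed : ∀ (S : Type) [PseudoEMetricSpace S] [MeasurableSpace S] [BorelSpace S] (Ωδ : ℝ → Type) [∀ δ, MeasurableSpace (Ωδ δ)] (Ω' : Type) [MeasurableSpace Ω'] (Y : (δ : ℝ) → Ωδ δ → S) (P : (δ : ℝ) → MeasureTheory.Measure (Ωδ δ)) (Z : Ω' → S) (P' : MeasureTheory.Measure Ω'), MeasureTheory.IsProbabilityMeasure P' → (∀ᶠ δ in (nhdsWithin (0:ℝ) (Set.Ioi 0)), MeasureTheory.IsProbabilityMeasure (P δ)) → (∀ᶠ δ in (nhdsWithin (0:ℝ) (Set.Ioi 0)), AEMeasurable (Y δ) (P δ)) → AEMeasurable Z P' → (Literature.Probability.RandomPlanarGeometry.TendstoLaw Y P Z P' ↔ ∀ F : Set S, IsClosed F → ∀ β : ENNReal, 0 < β → ∀ᶠ δ in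 (nhdsWithin (0:ℝ) (Set.Ioi 0)), P δ (Y δ ⁻¹' F) ≤ P' (Z ⁻¹' F) + β) := by
  intro S _ _ _ Ωδ _ Ω' _ Y P Z P' hP' hP hY hZ
  -- the limit law and the patched laws, as probability measures on `S`
  let μlim : ProbabilityMeasure S := ⟨P'.map Z, Measure.isProbabilityMeasure_map hZ⟩
  have hlim : (μlim : Measure S) = P'.map Z := rfl
  have hlimF : ∀ F : Set S, MeasurableSet F → (μlim : Measure S) F = P' (Z ⁻¹' F) := fun F hF ↦ by
    rw [hlim, Measure.map_apply_of_aemeasurable hZ hF]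
  obtain ⟨μ, hμ⟩ := exists_probabilityMeasure_eventually_eq_map (Y := Y) μlim hP hY
  rw [tendstoLaw_iff_tendsto_of_eventually_eq hZ hμ hlim]
  constructor
  · -- weak convergence ⟹ closed-set bound
    intro hconv F hF β hβ
    have h1 := ProbabilityMeasure.limsup_measure_closed_le_of_tendsto hconv hF
    rw [hlimF F hF.measurableSet] at h1
    filter_upwards [eventually_le_add_of_limsup_le (measure_ne_top _ _) hβ h1,
      eventually_apply_eq_of_eventually_eq hμ hF.measurableSet] with δ hδ hδ'
    rwa [← hδ']
  · -- closed-set bound ⟹ weak convergence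
    intro h
    refine tendsto_of_forall_isClosed_limsup_le' fun F hF ↦ ?_
    rw [hlimF F hF.measurableSet]
    refine limsup_le_of_forall_eventually_le_add fun β hβ ↦ ?_
    filter_upwards [h F hF β hβ, eventually_apply_eq_of_eventually_eq hμ hF.measurableSet]
      with δ hδ hδ'
    rwa [hδ']

end Summit.CriticalPhenomena.SAWScalingLimit.Theorems

end
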